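import Literature.Probability.Percolation.ArmEventsInterface
import Literature.Probability.Percolation.CLE6SubseqLimit
import Literature.Probability.Percolation.ArmExponentsTwoArmProofs
import HarnessLib

/-!
# Smirnov–Werner's (16) from the Camia–Newman loop limit: the two-arm scaling limit reduced to the continuum

Topic: Probability / Percolation. Proof-only companion of `ArmExponentsTwoArm.lean` (named fact
`SmirnovWerner2001_twoArm_scalingLimit`: S. Smirnov, W. Werner, Math. Res. Lett. **8** (2001),
§4, (16) with (9)/(15), `j = 2`) and of `ArmExponentsTwoArmProofs.lean` (the fact `⇔` (16)ℕ ∧ (9)ℕ).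
Smirnov–Werner derive (16) — `b_j(ρr, ρR)` has a limit `b'_j(R/r)` as `ρ → ∞` — from the full
scaling limit of critical percolation ([Sprep]; F. Camia, C. M. Newman, Comm. Math. Phys. 268
(2006), the tree's named fact `exists_isCNLFamily_tendsto` of `CLE6.lean`). This file carries out
that derivation for `j = 2` **given** the loop limit and an explicit continuity property of it,
reducing the lattice content of (16) to zero:

* the continuum hexagonal gauge `N(z) = max(|X|, |Y|, |X + Y|)` in the lattice coordinates
  `z = X + Yζ` of `TriLatticeSegments.lean` (definition `hexGauge`; `N(δx) = δ|x|_𝕋`,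
  `hexGauge_triMeshPoint`; `2`-Lipschitz, `hexGauge_le_hexGauge_add`) and the annulus-crossing
  events `Cross(a, b) = {L | ∃ c ∈ L, range c ∩ {N ≤ a} ≠ ∅, range c ∩ {N ≥ b} ≠ ∅}` of a loop
  collection (definition `loopHexCrossing a b`);
* **the sandwich** at mesh `ρ⁻¹` in a Jordan domain `D ⊇ B̄(0, R + 2)`
  (`exists_mem_triLoopCollection_cross_of_mem_armEvent`, `mem_armEvent_of_triLoopCollection_cross`):
  `{triLoopCollection D ρ⁻¹ ∈ Cross(r - ε, R + ε)} ⊆ armEvent (open, closed) (ρr) (ρR)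
   ⊆ {triLoopCollection D ρ⁻¹ ∈ Cross(r + ρ⁻¹, R - ρ⁻¹)}` for `ρε ≥ 10` — the lattice theorems
  of `ArmEventsInterface.lean` (two-arm event `⇔` an interface loop crosses the annulus) plus
  one-mesh bookkeeping (the arm event is determined by the annulus,
  `mem_armEvent_inter_triMeshVertices_iff`; members of the collection are limits of interface
  polygons; nearest lattice sites, `exists_dist_triMeshPoint_le`);
* **`tendsto_critTwoArmProb_of_tendstoLaw`** — if `triLoopCollection D δ → P'` in law
  (`TendstoLaw`, as in `exists_isCNLFamily_tendsto`) and `P'` gives measure zero to the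
  "near-miss" set `⋂_ε closure Cross(r+ε, R-ε) ∖ ⋃_ε interior Cross(r-ε, R+ε)`, then
  `b₂(ρr, ρR) → P'(Cross(r, R))` (portmanteau, both halves, Mathlib
  `ProbabilityMeasure.limsup_measure_closed_le_of_tendsto` / `le_liminf_measure_open_of_tendsto`,
  through `tendstoLaw_iff_tendsto_triLoopLaw` of `CLE6SubseqLimit.lean`);
* `measure_iInter_closure_diff_iUnion_interior_eq_zero` — the near-miss set is contained in the
  intrinsic event "every `ε`-near crossing of the hexagonal annulus exists but no member crosses
  it strictly" (Hausdorff-metric bookkeeping on `LoopSpace`), whose nullity is the continuum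
  **no-touching** property of the limit (for `CLE₆`: no loop touches the hexagons `N = r`, `N = R`
  without crossing, plus local finiteness);
* **`SmirnovWerner2001_twoArm_scalingLimit_of_loopLimit`**, **`…_of_cnl`** — the named fact from
  (a) convergence in law of the loop collections for every Jordan domain (the convergence half of
  `exists_isCNLFamily_tendsto`), (b) the no-touching property of the limits at the integer
  hexagonal annuli, (c) the exponent `-1/4` of the continuum crossing probabilities
  `P'_n(Cross(1, n))` along the integers (Smirnov–Werner (9) = (12) + (13) + (15) for `j = 2`: the
  radial `SLE₆` annulus-crossing exponent `ν(0) = 1/4` of Lawler–Schramm–Werner, Acta Math. 187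
  (2001), Thm 3.1) — via `SmirnovWerner2001_twoArm_scalingLimit_of_limits_nat`.

What remains for the named fact is therefore purely continuum: (b) and (c) for the Camia–Newman
limit (and the fact `exists_isCNLFamily_tendsto` itself). Everything here is proved; two
definitions (`hexGauge`, `loopHexCrossing`, with unfolding lemmas) and no named facts are
introduced.

## References

* S. Smirnov, W. Werner, Math. Res. Lett. 8 (2001) 729–744, §4 (9), (15), (16)
  [SmirnovWernerMRL2001].
* F. Camia, C. M. Newman, Comm. Math. Phys. 268 (2006), Thms 1–2, §2 [CamiaNewman2006].
* P. Billingsley, *Convergence of probability measures*, 2nd ed. (1999), Thm 2.1 (portmanteau)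
  [Billingsley1999].
-/

noncomputable section

open Set Metric Complex Filter MeasureTheory
open Literature.Topology.PlaneTopology Literature.Probability.RandomPlanarGeometry
open scoped unitInterval Topology ENNReal

namespace Literature.Probability.Percolation

open LatticeModels

/-! ### The continuum hexagonal gauge -/

/-- The **continuum hexagonal gauge** `N(z) = max (|X|, |Y|, |X + Y|)` of a point `z = X + Y ζ`
of the plane, in the lattice coordinates `X = triX z`, `Y = triY z` of `TriLatticeSegments.lean`:
the norm on `ℂ ≅ ℝ²` whose closed unit ball is the hexagon with vertices the sixth roots of unity,
and whose restriction to the embedded lattice `δ𝕋` is the rescaled graph norm,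
`N(δ x) = δ |x|_𝕋` (`hexGauge_triMeshPoint`), so that `{N ≤ s δ}` meets `δ𝕋` in the lattice
hexagon `δΛ_s` (Smirnov–Werner 2001, §4: the annuli `A(r, R)`, "in fact we modify `A(r, R)` as
`A_+(r, R)`", i.e. by lattice hexagons; Grimmett 1999, §11.9 Fig. 11.30 for `|·|_𝕋 = triNorm`).
[folklore] -/
def hexGauge (z : ℂ) : ℝ := max |triX z| (max |triY z| |triX z + triY z|)

/-- The gauge, unfolded. [folklore] -/
theorem hexGauge_def (z : ℂ) : hexGauge z = max |triX z| (max |triY z| |triX z + triY z|) := rfl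

/-- The gauge is nonnegative. [folklore] -/
theorem hexGauge_nonneg (z : ℂ) : 0 ≤ hexGauge z := (abs_nonneg _).trans (le_max_left _ _)

/-- The gauge of a nonnegative real number is the number itself (the positive real axis is a
lattice direction). [folklore] -/
theorem hexGauge_ofReal {x : ℝ} (hx : 0 ≤ x) : hexGauge (x : ℂ) = x := by
  simp [hexGauge, triX, triY, abs_of_nonneg hx, hx]

/-- The gauge of a mesh point: `N(δ x) = δ |x|_𝕋`. [folklore] -/
theorem hexGauge_triMeshPoint {δ : ℝ} (hδ : 0 ≤ δ) (v : Site 2) :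
    hexGauge (triMeshPoint δ v) = δ * triNorm v := by
  rw [hexGauge, triMeshPoint, triX_smul, triY_smul, triX_triEmbed, triY_triEmbed, ← mul_add, abs_mul, abs_mul,
    abs_mul, abs_of_nonneg hδ, ← mul_max_of_nonneg _ _ hδ, ← mul_max_of_nonneg _ _ hδ]
  congr 1
  simp only [triNorm]
  push_cast
  rfl

/-- The lattice coordinates are `2`-Lipschitz: `|X u| ≤ 2 ‖u‖`. [folklore] -/
theorem abs_triX_le (u : ℂ) : |triX u| ≤ 2 * ‖u‖ := by
  have h3 : (1 : ℝ) ≤ Real.sqrt 3 := Real.one_le_sqrt.2 (by norm_num)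
  have hre := Complex.abs_re_le_norm u
  have him := Complex.abs_im_le_norm u
  have h1 : |u.im / Real.sqrt 3| ≤ |u.im| := by
    rw [abs_div, abs_of_pos (by positivity : (0 : ℝ) < Real.sqrt 3)]
    exact div_le_self (abs_nonneg _) h3
  calc |triX u| = |u.re - u.im / Real.sqrt 3| := rfl
    _ ≤ |u.re| + |u.im / Real.sqrt 3| := abs_sub _ _
    _ ≤ ‖u‖ + ‖u‖ := add_le_add hre (h1.trans him)
    _ = 2 * ‖u‖ := by ring

/-- `|Y u| ≤ 2 ‖u‖`. [folklore] -/
theorem abs_triY_le (u : ℂ) : |triY u| ≤ 2 * ‖u‖ := by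
  have h3 : (1 : ℝ) ≤ Real.sqrt 3 := Real.one_le_sqrt.2 (by norm_num)
  have him := Complex.abs_im_le_norm u
  have h3pos : (0 : ℝ) < Real.sqrt 3 := by positivity
  calc |triY u| = |u.im| * 2 / Real.sqrt 3 := by
        rw [triY, abs_div, abs_mul, abs_of_pos h3pos, abs_two]
    _ ≤ |u.im| * 2 / 1 := by gcongr
    _ ≤ 2 * ‖u‖ := by linarith

/-- `|X u + Y u| ≤ 2 ‖u‖`. [folklore] -/
theorem abs_triX_add_triY_le (u : ℂ) : |triX u + triY u| ≤ 2 * ‖u‖ := by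
  have h3 : (1 : ℝ) ≤ Real.sqrt 3 := Real.one_le_sqrt.2 (by norm_num)
  have hre := Complex.abs_re_le_norm u
  have him := Complex.abs_im_le_norm u
  have h3pos : (0 : ℝ) < Real.sqrt 3 := by positivity
  have he : triX u + triY u = u.re + u.im / Real.sqrt 3 := by
    unfold triX triY; field_simp; ring
  have h1 : |u.im / Real.sqrt 3| ≤ |u.im| := by
    rw [abs_div, abs_of_pos h3pos]
    exact div_le_self (abs_nonneg _) h3
  rw [he]
  calc |u.re + u.im / Real.sqrt 3| ≤ |u.re| + |u.im / Real.sqrt 3| := abs_add_le _ _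
    _ ≤ ‖u‖ + ‖u‖ := add_le_add hre (h1.trans him)
    _ = 2 * ‖u‖ := by ring

/-- **The gauge is `2`-Lipschitz**: `N(z) ≤ N(w) + 2 ‖z - w‖`. [folklore] -/
theorem hexGauge_le_hexGauge_add (z w : ℂ) : hexGauge z ≤ hexGauge w + 2 * ‖z - w‖ := by
  simp only [hexGauge]
  have hz : z = w + (z - w) := by ring
  have e1 : triX z = triX w + triX (z - w) := by conv_lhs => rw [hz, triX_add]
  have e2 : triY z = triY w + triY (z - w) := by conv_lhs => rw [hz, triY_add]
  have a1 := abs_triX_le (z - w)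
  have a2 := abs_triY_le (z - w)
  have a3 := abs_triX_add_triY_le (z - w)
  rw [e1, e2]
  refine max_le ?_ (max_le ?_ ?_)
  · calc |triX w + triX (z - w)| ≤ |triX w| + |triX (z - w)| := abs_add_le _ _
      _ ≤ hexGauge w + 2 * ‖z - w‖ := add_le_add (le_max_left _ _) a1
  · calc |triY w + triY (z - w)| ≤ |triY w| + |triY (z - w)| := abs_add_le _ _
      _ ≤ hexGauge w + 2 * ‖z - w‖ := add_le_add ((le_max_left _ _).trans (le_max_right _ _)) a2
  · calc |triX w + triX (z - w) + (triY w + triY (z - w))|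
        = |(triX w + triY w) + (triX (z - w) + triY (z - w))| := by ring_nf
      _ ≤ |triX w + triY w| + |triX (z - w) + triY (z - w)| := abs_add_le _ _
      _ ≤ hexGauge w + 2 * ‖z - w‖ := add_le_add ((le_max_right _ _).trans (le_max_right _ _)) a3

/-! ### The annulus-crossing event of a loop collection -/

/-- The **hexagonal annulus-crossing event** `Cross(a, b)` of a loop collection: some curve
of the collection meets both the closed hexagon `{N ≤ a}` and the closed region `{N ≥ b}` — the
continuum counterpart of the polychromatic two-arm event of the lattice annulus `Λ_R ∖ Λ̊_r`
(`ArmEventsInterface.lean`: two arms of opposite colours `⇔` a cluster interface crosses the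
annulus), i.e. of Smirnov–Werner's event `H_2(r, R)` of probability `b_2(r, R)` read on the loop
ensemble (Math. Res. Lett. 8 (2001), §4, (16): `b'_j(R/r) = lim_ρ b_j(ρr, ρR)` "depends on the
ratio `R/r` only"). [cite: SmirnovWernerMRL2001, §4 (16)] -/
def loopHexCrossing (a b : ℝ) : Set (LoopSpace ℂ) :=
  {L | ∃ c ∈ L, (∃ z ∈ CurveClass.range c, hexGauge z ≤ a) ∧ ∃ z ∈ CurveClass.range c, b ≤ hexGauge z}

/-- Membership in the crossing event, unfolded. [folklore] -/
@[simp] theorem mem_loopHexCrossing {a b : ℝ} {L : LoopSpace ℂ} :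
    L ∈ loopHexCrossing a b ↔
      ∃ c ∈ L, (∃ z ∈ CurveClass.range c, hexGauge z ≤ a) ∧ ∃ z ∈ CurveClass.range c, b ≤ hexGauge z :=
  Iff.rfl

/-- Monotonicity of the crossing events in the two radii. [folklore] -/
theorem loopHexCrossing_mono {a a' b b' : ℝ} (ha : a ≤ a') (hb : b' ≤ b) : loopHexCrossing a b ⊆ loopHexCrossing a' b' := by
  rintro L ⟨c, hc, ⟨z, hz, hza⟩, z', hz', hzb⟩
  exact ⟨c, hc, ⟨z, hz, hza.trans ha⟩, z', hz', hb.trans hzb⟩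

/-- The trace of the curve class of a closed walk is its polygonal trace. [folklore] -/
theorem range_siteLoopCurve {f₀ : HexVertex} {w : hexGraph.Walk f₀ f₀} (hlen : 0 < w.length) (δ : ℝ) :
    CurveClass.range (siteLoopCurve δ w) = polyTrace δ w := by
  rw [siteLoopCurve, CurveClass.range_mk]
  exact range_toCurve_eq_polyTrace hlen

/-! ### Restriction to the mesh vertices of a large domain does not affect the arm event -/

/-- Sites of the ball `Λ_{ρR}` have their mesh-`ρ⁻¹` points in the closed disc of radius `R`.
[folklore] -/
theorem norm_triMeshPoint_inv_le {ρ : ℕ} (hρ : 1 ≤ ρ) {R : ℕ} {v : Site 2} (hv : triNorm v ≤ ρ * R) :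
    ‖triMeshPoint (ρ : ℝ)⁻¹ v‖ ≤ R := by
  have hρ' : (0 : ℝ) < ρ := by exact_mod_cast hρ
  rw [triMeshPoint, norm_mul, Complex.norm_real, Real.norm_eq_abs, abs_of_pos (inv_pos.2 hρ'),
    inv_mul_le_iff₀ hρ']
  calc ‖triEmbed v‖ ≤ triNorm v := norm_triEmbed_le_triNorm v
    _ ≤ (ρ : ℝ) * R := by exact_mod_cast hv

/-- **The arm event of `Λ_{ρR} ∖ Λ̊_{ρr}` is not affected by closing the sites whose mesh-`ρ⁻¹`
points lie outside a domain containing the closed disc of radius `R`** (the event is determined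
by the sites of the annulus, `determinedBy_armEvent`). [folklore] -/
theorem mem_armEvent_inter_triMeshVertices_iff {k : ℕ} (κ : Fin k → Bool) {r R ρ : ℕ} (hρ : 1 ≤ ρ)
    (hrR : r ≤ R) {Ω : Set ℂ} (hΩ : closedBall (0 : ℂ) R ⊆ Ω) (ω : SiteConfig (Site 2)) :
    ω ∩ triMeshVertices Ω (ρ : ℝ)⁻¹ ∈ armEvent κ (ρ * r) (ρ * R) ↔ ω ∈ armEvent κ (ρ * r) (ρ * R) := by
  have hdet := (determinedBy_iff _ _).1 (determinedBy_armEvent κ (Nat.mul_le_mul_left ρ hrR))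
  have hsub : (↑(triAnnulus (ρ * r) (ρ * R)) : Set (Site 2)) ⊆ triMeshVertices Ω (ρ : ℝ)⁻¹ := by
    intro v hv
    rw [Finset.mem_coe, mem_triAnnulus] at hv
    exact hΩ (mem_closedBall_zero_iff.2 (norm_triMeshPoint_inv_le hρ hv.2))
  refine hdet _ _ ?_
  rw [Set.inter_assoc, Set.inter_eq_right.2 hsub]

/-! ### The sandwich: arms versus crossings of the loop collection -/

/-- **Arms give a crossing of the loop collection.** If `ω ∈ armEvent (open, closed) (ρr) (ρR)`
(`1 ≤ r ≤ R`, `ρ ≥ 1`) and the Jordan domain `D` contains the closed disc of radius `R + 2`, then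
some member of the loop collection `triLoopCollection D ρ⁻¹ ω` meets `{N ≤ r + ρ⁻¹}` and
`{N ≥ R - ρ⁻¹}` (`exists_isSiteInterfaceLoop_polyTrace_of_mem_armEvent_two` for the restricted
configuration, whose interface loops are members of the collection). [cite: SmirnovWernerMRL2001, §4 Remark 6 and (15)] -/
theorem exists_mem_triLoopCollection_cross_of_mem_armEvent {r R : ℕ} (hr : 1 ≤ r) (hrR : r ≤ R) {ρ : ℕ}
    (hρ : 1 ≤ ρ) (D : JordanDomain) (hD : closedBall (0 : ℂ) (R + 2) ⊆ D.carrier) {ω : SiteConfig (Site 2)}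
    (hω : ω ∈ armEvent ![true, false] (ρ * r) (ρ * R)) :
    triLoopCollection D (ρ : ℝ)⁻¹ ω ∈ (loopHexCrossing ((r : ℝ) + (ρ : ℝ)⁻¹) ((R : ℝ) - (ρ : ℝ)⁻¹)) := by
  set δ : ℝ := (ρ : ℝ)⁻¹ with hδdef
  have hρ' : (0 : ℝ) < ρ := by exact_mod_cast hρ
  have hδ : 0 < δ := inv_pos.2 hρ'
  have hδρ : δ * ρ = 1 := inv_mul_cancel₀ hρ'.ne'
  set ω' : SiteConfig (Site 2) := ω ∩ triMeshVertices D.carrier δ with hω'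
  have hfin : ω'.Finite := (triMeshVertices_finite_holds D.isBounded hδ).subset inter_subset_right
  have hΩ : closedBall (0 : ℂ) R ⊆ D.carrier := (closedBall_subset_closedBall (by linarith)).trans hD
  have hω'arm : ω' ∈ armEvent ![true, false] (ρ * r) (ρ * R) :=
    (mem_armEvent_inter_triMeshVertices_iff _ hρ hrR hΩ ω).2 hω
  obtain ⟨F, w, hw, ⟨z₁, hz₁, v₁, hv₁, hd₁⟩, z₂, hz₂, v₂, hv₂, hd₂⟩ :=
    exists_isSiteInterfaceLoop_polyTrace_of_mem_armEvent_two hfin (le_trans hρ (Nat.le_mul_of_pos_right ρ hr))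
      (Nat.mul_le_mul_left ρ hrR) hω'arm hδ
  have hlen : 0 < w.length := by have := hw.isCycle.three_le_length; omega
  refine ⟨siteLoopCurve δ w, siteLoopCurve_mem_triLoopCollection hw, ?_, ?_⟩
  · refine ⟨z₁, by rw [range_siteLoopCurve hlen]; exact hz₁, ?_⟩
    have h1 := hexGauge_le_hexGauge_add z₁ (triMeshPoint δ v₁)
    rw [hexGauge_triMeshPoint hδ.le, ← dist_eq_norm] at h1
    have hv₁' : (triNorm v₁ : ℝ) = ρ * r - 1 := by
      have : (triNorm v₁ : ℝ) + 1 = ((ρ * r : ℕ) : ℤ) := by exact_mod_cast hv₁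
      push_cast at this; linarith
    rw [hv₁'] at h1
    have : δ * (ρ * r - 1) + 2 * dist z₁ (triMeshPoint δ v₁) ≤ r + δ := by
      have : δ * (ρ * r - 1) = r - δ := by rw [mul_sub, ← mul_assoc, hδρ, one_mul, mul_one]
      rw [this]; linarith
    exact h1.trans this
  · refine ⟨z₂, by rw [range_siteLoopCurve hlen]; exact hz₂, ?_⟩
    have h2 := hexGauge_le_hexGauge_add (triMeshPoint δ v₂) z₂
    rw [hexGauge_triMeshPoint hδ.le, ← dist_eq_norm, dist_comm] at h2
    have hv₂' : (triNorm v₂ : ℝ) = ρ * R + 1 := by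
      have : (triNorm v₂ : ℝ) = ((ρ * R : ℕ) : ℤ) + 1 := by exact_mod_cast hv₂
      push_cast at this; linarith
    rw [hv₂'] at h2
    have : δ * (ρ * R + 1) = R + δ := by rw [mul_add, ← mul_assoc, hδρ, one_mul, mul_one]
    rw [this] at h2
    linarith

/-- **A robust crossing of the loop collection gives the arms.** If some member of
`triLoopCollection D ρ⁻¹ ω` meets `{N ≤ r - ε}` and `{N ≥ R + ε}` (`ε > 0`, `ρ ε ≥ 10`, `ρ ≥ 3`,
`D ⊇` closed disc of radius `R + 2`), then `ω ∈ armEvent (open, closed) (ρr) (ρR)`: the member is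
within `ε/4` of the curve class of an interface loop of the restricted configuration, whose trace
then meets `{N ≤ r - ε/2}` and `{N ≥ R + ε/2}`, and `IsSiteInterfaceLoop.mem_armEvent_two_of_polyTrace`
applies with the nearest lattice sites. [cite: SmirnovWernerMRL2001, §4 Remark 6 and (15)] -/
theorem mem_armEvent_of_triLoopCollection_cross {r R : ℕ} (hr : 1 ≤ r) (hrR : r ≤ R) {ε : ℝ} (hε : 0 < ε)
    {ρ : ℕ} (hρ3 : 3 ≤ ρ) (hρε : 10 ≤ (ρ : ℝ) * ε) (D : JordanDomain)
    (hD : closedBall (0 : ℂ) (R + 2) ⊆ D.carrier) {ω : SiteConfig (Site 2)}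
    (h : triLoopCollection D (ρ : ℝ)⁻¹ ω ∈ (loopHexCrossing ((r : ℝ) - ε) ((R : ℝ) + ε))) :
    ω ∈ armEvent ![true, false] (ρ * r) (ρ * R) := by
  set δ : ℝ := (ρ : ℝ)⁻¹ with hδdef
  have hρ1 : 1 ≤ ρ := by omega
  have hρ' : (0 : ℝ) < ρ := by exact_mod_cast hρ1
  have hδ : 0 < δ := inv_pos.2 hρ'
  have hδρ : δ * ρ = 1 := inv_mul_cancel₀ hρ'.ne'
  set ω' : SiteConfig (Site 2) := ω ∩ triMeshVertices D.carrier δ with hω'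
  have hΩ : closedBall (0 : ℂ) R ⊆ D.carrier := (closedBall_subset_closedBall (by linarith)).trans hD
  rw [← mem_armEvent_inter_triMeshVertices_iff _ hρ1 hrR hΩ ω]
  obtain ⟨c, hc, ⟨z₁, hz₁, h1⟩, z₂, hz₂, h2⟩ := h
  -- a nearby interface loop of the restricted configuration
  have hc' : c ∈ closure {c | ∃ (f : HexVertex) (γ : hexGraph.Walk f f),
      IsSiteInterfaceLoop ω' γ ∧ c = siteLoopCurve δ γ} := hc
  obtain ⟨c', ⟨f, γ, hγ, rfl⟩, hcc'⟩ := Metric.mem_closure_iff.1 hc' (ε / 4) (by positivity)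
  have hlen : 0 < γ.length := by have := hγ.isCycle.three_le_length; omega
  obtain ⟨γc, rfl⟩ := CurveClass.surjective_mk c
  have hdist : dist γc ⟨γ.toCurve fun v ↦ (δ : ℂ) * hexCenter v⟩ < ε / 4 := by
    rwa [siteLoopCurve, CurveClass.mk_eq_separationQuotientMk, SeparationQuotient.dist_mk] at hcc'
  have hrange : Curve.range (⟨γ.toCurve fun v ↦ (δ : ℂ) * hexCenter v⟩ : Curve ℂ) = polyTrace δ γ :=
    range_toCurve_eq_polyTrace hlen
  have hne : (polyTrace δ γ).Nonempty := by rw [← hrange]; exact Curve.range_nonempty _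
  -- trace points of the interface loop near `z₁` and `z₂`
  have key : ∀ {z : ℂ}, z ∈ CurveClass.range (CurveClass.mk γc) → ∃ z' ∈ polyTrace δ γ, dist z z' < ε / 4 := by
    intro z hz
    rw [CurveClass.range_mk] at hz
    obtain ⟨t, rfl⟩ := Curve.mem_range.1 hz
    have := (Curve.infDist_range_le γc ⟨γ.toCurve fun v ↦ (δ : ℂ) * hexCenter v⟩ t).trans_lt hdist
    rw [hrange] at this
    exact (Metric.infDist_lt_iff hne).1 this
  obtain ⟨z₁', hz₁', hd₁⟩ := key hz₁
  obtain ⟨z₂', hz₂', hd₂⟩ := key hz₂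
  -- nearest lattice sites
  obtain ⟨v₁, hv₁'⟩ := exists_dist_triMeshPoint_le hδ z₁'
  obtain ⟨v₂, hv₂'⟩ := exists_dist_triMeshPoint_le hδ z₂'
  have hv₁ : dist z₁' (triMeshPoint δ v₁) ≤ δ := hv₁'.trans (by linarith)
  have hv₂ : dist z₂' (triMeshPoint δ v₂) ≤ δ := hv₂'.trans (by linarith)
  have hN₁ : δ * triNorm v₁ ≤ r - ε / 2 + 2 * δ := by
    have a := hexGauge_le_hexGauge_add (triMeshPoint δ v₁) z₁'
    have b := hexGauge_le_hexGauge_add z₁' z₁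
    rw [hexGauge_triMeshPoint hδ.le, ← dist_eq_norm, dist_comm] at a
    rw [← dist_eq_norm, dist_comm] at b
    linarith
  have hN₂ : (R : ℝ) + ε / 2 - 2 * δ ≤ δ * triNorm v₂ := by
    have a := hexGauge_le_hexGauge_add z₂' (triMeshPoint δ v₂)
    have b := hexGauge_le_hexGauge_add z₂ z₂'
    rw [hexGauge_triMeshPoint hδ.le, ← dist_eq_norm] at a
    rw [← dist_eq_norm] at b
    linarith
  -- in lattice units
  have hρr3 : 3 ≤ ρ * r := le_trans hρ3 (Nat.le_mul_of_pos_right ρ hr)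
  have hv₁n : triNorm v₁ ≤ ((ρ * r - 3 : ℕ) : ℤ) := by
    have h' : (triNorm v₁ : ℝ) ≤ ρ * r - 3 := by
      have e : (triNorm v₁ : ℝ) = ρ * (δ * triNorm v₁) := by rw [← mul_assoc, mul_comm (ρ : ℝ), hδρ, one_mul]
      have e2 : (ρ : ℝ) * (r - ε / 2 + 2 * δ) = ρ * r - ρ * ε / 2 + 2 := by
        rw [show (ρ : ℝ) * (r - ε / 2 + 2 * δ) = ρ * r - ρ * ε / 2 + 2 * (δ * ρ) by ring, hδρ]; ring
      rw [e]
      nlinarith [mul_le_mul_of_nonneg_left hN₁ hρ'.le]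
    have h'' : (triNorm v₁ : ℝ) ≤ ((ρ * r - 3 : ℕ) : ℤ) := by push_cast [hρr3]; exact h'
    exact_mod_cast h''
  have hv₂n : (((ρ * R + 3 : ℕ)) : ℤ) ≤ triNorm v₂ := by
    have h' : (ρ : ℝ) * R + 3 ≤ triNorm v₂ := by
      have e : (triNorm v₂ : ℝ) = ρ * (δ * triNorm v₂) := by rw [← mul_assoc, mul_comm (ρ : ℝ), hδρ, one_mul]
      rw [e]
      have e2 : (ρ : ℝ) * (R + ε / 2 - 2 * δ) = ρ * R + ρ * ε / 2 - 2 := by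
        rw [show (ρ : ℝ) * (R + ε / 2 - 2 * δ) = ρ * R + ρ * ε / 2 - 2 * (δ * ρ) by ring, hδρ]; ring
      nlinarith [mul_le_mul_of_nonneg_left hN₂ hρ'.le]
    have h'' : (((ρ * R + 3 : ℕ) : ℤ) : ℝ) ≤ triNorm v₂ := by push_cast; exact h'
    exact_mod_cast h''
  have hmul : ρ * r ≤ ρ * R := Nat.mul_le_mul_left ρ hrR
  have harm := hγ.mem_armEvent_two_of_polyTrace hδ (r := ρ * r - 3) (R := ρ * R + 3) (by omega)
    hz₁' hz₂' hv₁n hv₁ hv₂n hv₂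
  rwa [show ρ * r - 3 + 3 = ρ * r by omega, show ρ * R + 3 - 3 = ρ * R by omega] at harm

/-! ### Convergence of the two-arm probabilities from the loop limit -/

/-- Meshes `ρ⁻¹`, `ρ → ∞` in `ℕ`, tend to `0⁺`. [folklore] -/
theorem tendsto_inv_natCast_nhdsGT_zero : Tendsto (fun ρ : ℕ ↦ (ρ : ℝ)⁻¹) atTop (𝓝[>] (0 : ℝ)) :=
  tendsto_inv_atTop_nhdsGT_zero.comp tendsto_natCast_atTop_atTop

/-- **Smirnov–Werner's (16) on integer annuli from the loop scaling limit and a no-near-miss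
property of the limit.** Let `1 ≤ r ≤ R`, let the Jordan domain `D` contain the closed disc of
radius `R + 2`, and let the loop collections `triLoopCollection D δ` of critical site percolation
converge in law as `δ → 0⁺` to a probability law `P'` on `LoopSpace ℂ` (as asserted, for every
`D`, by the Camia–Newman fact `exists_isCNLFamily_tendsto`). Write `Cross(a, b)` for the event that
some curve of the collection meets both `{N ≤ a}` and `{N ≥ b}` (`N` the hexagonal gauge,
`N(δx) = δ|x|_𝕋`). If `P'`-almost surely a collection lying in every
`closure Cross(r + ε, R - ε)` lies in some `interior Cross(r - ε, R + ε)` (no loop "just touches"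
the hexagons `N = r`, `N = R`: the continuum no-near-miss property), then the two-arm
probabilities of the integer annuli converge: `b₂(ρr, ρR) → P'(Cross(r, R))` as `ρ → ∞` — the
statement `lim_ρ b_j(ρr, ρR) = b'_j` of Smirnov–Werner 2001, §4 (16) for `j = 2`, which the
source infers from the scaling limit [Sprep]. Proof: portmanteau (Mathlib
`ProbabilityMeasure.limsup_measure_closed_le_of_tendsto`, `le_liminf_measure_open_of_tendsto`)
applied to the sandwich `{Cross(r-ε, R+ε)} ⊆ {two arms} ⊆ {Cross(r+ε, R-ε)}`
(`mem_armEvent_of_triLoopCollection_cross`, `exists_mem_triLoopCollection_cross_of_mem_armEvent`).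
[cite: SmirnovWernerMRL2001, §4 (16)] -/
theorem tendsto_critTwoArmProb_of_tendstoLaw {r R : ℕ} (hr : 1 ≤ r) (hrR : r ≤ R) (D : JordanDomain)
    (hD : closedBall (0 : ℂ) (R + 2) ⊆ D.carrier) {P' : Measure (LoopSpace ℂ)} [IsProbabilityMeasure P']
    (hconv : TendstoLaw (Ωδ := fun _ ↦ SiteConfig (Site 2)) (fun δ ↦ triLoopCollection D δ)
      (fun _ ↦ triSitePercolation half) id P')
    (hnull : P' ((⋂ n : ℕ, closure (loopHexCrossing ((r : ℝ) + ((n : ℝ) + 1)⁻¹) ((R : ℝ) - ((n : ℝ) + 1)⁻¹))) \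
      ⋃ n : ℕ, interior (loopHexCrossing ((r : ℝ) - ((n : ℝ) + 1)⁻¹) ((R : ℝ) + ((n : ℝ) + 1)⁻¹))) = 0) :
    Tendsto (fun ρ : ℕ ↦ critTwoArmProb (ρ * r) (ρ * R)) atTop (𝓝 (P'.real (loopHexCrossing (r : ℝ) (R : ℝ)))) := by
  set Cl : ℕ → Set (LoopSpace ℂ) := fun n ↦ closure (loopHexCrossing ((r : ℝ) + ((n : ℝ) + 1)⁻¹) ((R : ℝ) - ((n : ℝ) + 1)⁻¹))
    with hCl
  set Op : ℕ → Set (LoopSpace ℂ) := fun n ↦ interior (loopHexCrossing ((r : ℝ) - ((n : ℝ) + 1)⁻¹) ((R : ℝ) + ((n : ℝ) + 1)⁻¹))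
    with hOp
  have hεpos : ∀ n : ℕ, (0 : ℝ) < ((n : ℝ) + 1)⁻¹ := fun n ↦ by positivity
  have hεanti : ∀ {n m : ℕ}, n ≤ m → ((m : ℝ) + 1)⁻¹ ≤ ((n : ℝ) + 1)⁻¹ := fun {n m} h ↦
    inv_anti₀ (by positivity) (by exact_mod_cast Nat.succ_le_succ h)
  have hCl_anti : Antitone Cl := fun n m h ↦
    closure_mono (loopHexCrossing_mono (by linarith [hεanti h]) (by linarith [hεanti h]))
  have hOp_mono : Monotone Op := fun n m h ↦
    interior_mono (loopHexCrossing_mono (by linarith [hεanti h]) (by linarith [hεanti h]))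
  have hOpC : ∀ n, Op n ⊆ (loopHexCrossing (r : ℝ) (R : ℝ)) := fun n ↦
    interior_subset.trans (loopHexCrossing_mono (by linarith [hεpos n]) (by linarith [hεpos n]))
  have hCCl : ∀ n, (loopHexCrossing (r : ℝ) (R : ℝ)) ⊆ Cl n := fun n ↦
    (loopHexCrossing_mono (by linarith [hεpos n]) (by linarith [hεpos n])).trans subset_closure
  -- the common value
  have hUI : (⋃ n, Op n) ⊆ ⋂ n, Cl n :=
    iUnion_subset fun n ↦ subset_iInter fun m ↦ (hOpC n).trans (hCCl m)
  have heq : P' (⋃ n, Op n) = P' (⋂ n, Cl n) := measure_eq_measure_of_null_sdiff hUI hnull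
  have hvalU : P' (loopHexCrossing (r : ℝ) (R : ℝ)) = P' (⋃ n, Op n) :=
    le_antisymm (heq ▸ measure_mono (subset_iInter hCCl)) (measure_mono (iUnion_subset hOpC))
  have hvalI : P' (loopHexCrossing (r : ℝ) (R : ℝ)) = P' (⋂ n, Cl n) := hvalU.trans heq
  have hU : P' (⋃ n, Op n) = ⨆ n, P' (Op n) := hOp_mono.measure_iUnion
  have hI : P' (⋂ n, Cl n) = ⨅ n, P' (Cl n) :=
    hCl_anti.measure_iInter (fun n ↦ isClosed_closure.measurableSet.nullMeasurableSet) ⟨0, measure_ne_top _ _⟩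
  -- weak convergence of the laws
  have hT : Tendsto (triLoopLaw D) (𝓝[>] 0) (𝓝 ⟨P', inferInstance⟩) :=
    (tendstoLaw_iff_tendsto_triLoopLaw D).1 hconv
  rw [tendsto_order]
  refine ⟨fun a ha ↦ ?_, fun b hb ↦ ?_⟩
  · -- lower bound: robust crossings of the limit give arms
    rcases lt_or_ge a 0 with ha0 | ha0
    · exact Eventually.of_forall fun ρ ↦ ha0.trans_le measureReal_nonneg
    have h1 : ENNReal.ofReal a < ⨆ n, P' (Op n) := by
      rw [← hU, ← hvalU]
      exact (ENNReal.ofReal_lt_iff_lt_toReal ha0 (measure_ne_top _ _)).2 ha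
    obtain ⟨n, hn⟩ := lt_iSup_iff.1 h1
    have hport := ProbabilityMeasure.le_liminf_measure_open_of_tendsto hT (isOpen_interior : IsOpen (Op n))
    have h3 := Filter.eventually_lt_of_lt_liminf (hn.trans_le hport)
    have h4 := tendsto_inv_natCast_nhdsGT_zero.eventually h3
    filter_upwards [h4, eventually_ge_atTop (10 * (n + 1) + 3)] with ρ hρa hρge
    have hρ3 : 3 ≤ ρ := by omega
    have hρpos : (0 : ℝ) < (ρ : ℝ)⁻¹ := inv_pos.2 (by exact_mod_cast (show 0 < ρ by omega))
    have hρε : 10 ≤ (ρ : ℝ) * ((n : ℝ) + 1)⁻¹ := by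
      rw [← div_eq_mul_inv, le_div_iff₀ (by positivity)]
      exact_mod_cast (show 10 * (n + 1) ≤ ρ by omega)
    rw [triLoopLaw_apply hρpos isOpen_interior.measurableSet] at hρa
    have hsub : {ω | triLoopCollection D (ρ : ℝ)⁻¹ ω ∈ Op n} ⊆ armEvent ![true, false] (ρ * r) (ρ * R) :=
      fun ω hω ↦ mem_armEvent_of_triLoopCollection_cross hr hrR (hεpos n) hρ3 hρε D hD (interior_subset hω)
    have h5 := hρa.trans_le (measure_mono hsub)
    exact (ENNReal.ofReal_lt_iff_lt_toReal ha0 (measure_ne_top _ _)).1 h5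
  · -- upper bound: arms give crossings of the limit
    have h1 : ⨅ n, P' (Cl n) < ENNReal.ofReal b := by
      rw [← hI, ← hvalI]
      exact (ENNReal.lt_ofReal_iff_toReal_lt (measure_ne_top _ _)).2 hb
    obtain ⟨n, hn⟩ := iInf_lt_iff.1 h1
    have hport := ProbabilityMeasure.limsup_measure_closed_le_of_tendsto hT (isClosed_closure : IsClosed (Cl n))
    have h3 := Filter.eventually_lt_of_limsup_lt (hport.trans_lt hn)
    have h4 := tendsto_inv_natCast_nhdsGT_zero.eventually h3
    filter_upwards [h4, eventually_ge_atTop (n + 1)] with ρ hρb hρge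
    have hρ1 : 1 ≤ ρ := by omega
    have hρpos : (0 : ℝ) < (ρ : ℝ)⁻¹ := inv_pos.2 (by exact_mod_cast (show 0 < ρ by omega))
    have hρn : (ρ : ℝ)⁻¹ ≤ ((n : ℝ) + 1)⁻¹ := inv_anti₀ (by positivity) (by exact_mod_cast hρge)
    rw [triLoopLaw_apply hρpos isClosed_closure.measurableSet] at hρb
    have hsub : armEvent ![true, false] (ρ * r) (ρ * R) ⊆ {ω | triLoopCollection D (ρ : ℝ)⁻¹ ω ∈ Cl n} :=
      fun ω hω ↦ subset_closure (loopHexCrossing_mono (by linarith) (by linarith)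
        (exists_mem_triLoopCollection_cross_of_mem_armEvent hr hrR hρ1 D hD hω))
    exact ENNReal.toReal_lt_of_lt_ofReal ((measure_mono hsub).trans_lt hρb)

/-! ### The no-near-miss property in intrinsic form -/

/-- A member of a nearby collection has a nearby member: if `edist L L' < ENNReal.ofReal η` and
`c' ∈ L'`, some `c ∈ L` has every point of the trace of `c'` within `η` of its trace, so the
gauge extrema move by at most `2η`. [folklore] -/
theorem exists_mem_hexGauge_near {L L' : LoopSpace ℂ} {η : ℝ} (h : edist L L' < ENNReal.ofReal η)
    {c' : CurveClass ℂ} (hc' : c' ∈ L') :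
    ∃ c ∈ L, (∀ z' ∈ CurveClass.range c', ∃ z ∈ CurveClass.range c, hexGauge z ≤ hexGauge z' + 2 * η) ∧
      ∀ z' ∈ CurveClass.range c', ∃ z ∈ CurveClass.range c, hexGauge z' - 2 * η ≤ hexGauge z := by
  rw [TopologicalSpace.Closeds.edist_eq, hausdorffEDist_comm] at h
  obtain ⟨c, hc, hlt⟩ := exists_edist_lt_of_hausdorffEDist_lt hc' h
  obtain ⟨γ', rfl⟩ := CurveClass.surjective_mk c'
  obtain ⟨γ, rfl⟩ := CurveClass.surjective_mk c
  rw [edist_lt_ofReal, CurveClass.dist_mk_mk] at hlt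
  have key : ∀ z' ∈ CurveClass.range (CurveClass.mk γ'), ∃ z ∈ CurveClass.range (CurveClass.mk γ), dist z' z < η := by
    intro z' hz'
    rw [CurveClass.range_mk] at hz'
    obtain ⟨t, rfl⟩ := Curve.mem_range.1 hz'
    have := (Curve.infDist_range_le γ' γ t).trans_lt hlt
    exact (Metric.infDist_lt_iff (Curve.range_nonempty γ)).1 this
  refine ⟨CurveClass.mk γ, hc, fun z' hz' ↦ ?_, fun z' hz' ↦ ?_⟩
  · obtain ⟨z, hz, hd⟩ := key z' hz'
    refine ⟨z, hz, ?_⟩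
    have := hexGauge_le_hexGauge_add z z'
    rw [← dist_eq_norm, dist_comm] at this
    linarith
  · obtain ⟨z, hz, hd⟩ := key z' hz'
    refine ⟨z, hz, ?_⟩
    have := hexGauge_le_hexGauge_add z' z
    rw [← dist_eq_norm] at this
    linarith

/-- **Limits of near-crossing collections nearly cross**: a collection in every
`closure Cross(r + ε, R - ε)` has, for every `ε > 0`, a member meeting `{N ≤ r + ε}` and
`{N ≥ R - ε}`. [folklore] -/
theorem iInter_closure_cross_subset (r R : ℝ) :
    (⋂ n : ℕ, closure (loopHexCrossing (r + ((n : ℝ) + 1)⁻¹) (R - ((n : ℝ) + 1)⁻¹))) ⊆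
      {L : LoopSpace ℂ | ∀ ε > 0, ∃ c ∈ L, (∃ z ∈ CurveClass.range c, hexGauge z ≤ r + ε) ∧
        ∃ z ∈ CurveClass.range c, R - ε ≤ hexGauge z} := by
  intro L hL ε hε
  obtain ⟨n, hn⟩ := exists_nat_one_div_lt (half_pos hε)
  rw [one_div] at hn
  have hLn := mem_iInter.1 hL n
  obtain ⟨L', ⟨c', hc', ⟨z₁, hz₁, h₁⟩, z₂, hz₂, h₂⟩, hLL'⟩ :=
    EMetric.mem_closure_iff.1 hLn (ENNReal.ofReal (ε / 4)) (by simpa using (by positivity : (0 : ℝ) < ε / 4))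
  obtain ⟨c, hc, hup, hdown⟩ := exists_mem_hexGauge_near hLL' hc'
  obtain ⟨w₁, hw₁, hw₁N⟩ := hup z₁ hz₁
  obtain ⟨w₂, hw₂, hw₂N⟩ := hdown z₂ hz₂
  exact ⟨c, hc, ⟨w₁, hw₁, by linarith⟩, w₂, hw₂, by linarith⟩

/-- **Strictly crossing collections cross robustly**: a collection with a member meeting
`{N < r}` and `{N > R}` lies in the interior of some `Cross(r - ε, R + ε)`. [folklore] -/
theorem setOf_strictCross_subset_iUnion_interior (r R : ℝ) :
    {L : LoopSpace ℂ | ∃ c ∈ L, (∃ z ∈ CurveClass.range c, hexGauge z < r) ∧ ∃ z ∈ CurveClass.range c, R < hexGauge z} ⊆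
      ⋃ n : ℕ, interior (loopHexCrossing (r - ((n : ℝ) + 1)⁻¹) (R + ((n : ℝ) + 1)⁻¹)) := by
  rintro L ⟨c, hc, ⟨z₁, hz₁, h₁⟩, z₂, hz₂, h₂⟩
  set g : ℝ := min (r - hexGauge z₁) (hexGauge z₂ - R) with hg
  have hgpos : 0 < g := lt_min (by linarith) (by linarith)
  have hg1 : g ≤ r - hexGauge z₁ := min_le_left _ _
  have hg2 : g ≤ hexGauge z₂ - R := min_le_right _ _
  obtain ⟨n, hn⟩ := exists_nat_one_div_lt (half_pos hgpos)
  rw [one_div] at hn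
  refine mem_iUnion.2 ⟨n, ?_⟩
  rw [mem_interior_iff_mem_nhds]
  refine Filter.mem_of_superset (Metric.eball_mem_nhds L (show (0 : ℝ≥0∞) < ENNReal.ofReal (g / 4) by
    simpa using (by positivity : (0 : ℝ) < g / 4))) fun L' hL' ↦ ?_
  rw [Metric.mem_eball] at hL'
  obtain ⟨c', hc', hup, hdown⟩ := exists_mem_hexGauge_near hL' hc
  obtain ⟨w₁, hw₁, hw₁N⟩ := hup z₁ hz₁
  obtain ⟨w₂, hw₂, hw₂N⟩ := hdown z₂ hz₂
  exact ⟨c', hc', ⟨w₁, hw₁, by linarith⟩, w₂, hw₂, by linarith⟩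

/-- **The no-near-miss null set, intrinsic form.** The null-set hypothesis of
`tendsto_critTwoArmProb_of_tendstoLaw` follows from: almost surely, a collection all of whose
`ε`-near-crossings of the hexagonal annulus `r ≤ N ≤ R` exist (for every `ε > 0` some member
meets `{N ≤ r + ε}` and `{N ≥ R - ε}`) has a member crossing it strictly (meeting `{N < r}` and
`{N > R}`) — for the Camia–Newman limit: local finiteness plus "no loop touches the hexagons
`N = r`, `N = R` without crossing them". [folklore] -/
theorem measure_iInter_closure_diff_iUnion_interior_eq_zero {P' : Measure (LoopSpace ℂ)} {r R : ℝ}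
    (h : P' {L : LoopSpace ℂ | (∀ ε > 0, ∃ c ∈ L, (∃ z ∈ CurveClass.range c, hexGauge z ≤ r + ε) ∧
        ∃ z ∈ CurveClass.range c, R - ε ≤ hexGauge z) ∧
      ¬ ∃ c ∈ L, (∃ z ∈ CurveClass.range c, hexGauge z < r) ∧ ∃ z ∈ CurveClass.range c, R < hexGauge z} = 0) :
    P' ((⋂ n : ℕ, closure (loopHexCrossing (r + ((n : ℝ) + 1)⁻¹) (R - ((n : ℝ) + 1)⁻¹))) \
      ⋃ n : ℕ, interior (loopHexCrossing (r - ((n : ℝ) + 1)⁻¹) (R + ((n : ℝ) + 1)⁻¹))) = 0 := by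
  refine measure_mono_null (fun L hL ↦ ?_) h
  exact ⟨iInter_closure_cross_subset r R hL.1, fun hs ↦ hL.2 (setOf_strictCross_subset_iUnion_interior r R hs)⟩

/-! ### The named fact from the loop limit -/

/-- **`SmirnovWerner2001_twoArm_scalingLimit` from the Camia–Newman loop limit plus two
properties of the limit.** Let `ν D` be probability laws on `LoopSpace ℂ` to which the loop
collections `triLoopCollection D δ` converge in law for every Jordan domain `D` (the convergence
half of `exists_isCNLFamily_tendsto`), and let `Dn n` be Jordan domains containing the closed
discs of radius `n + 2`. If the limits have the no-near-miss property at the integer hexagonal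
annuli (`tendsto_critTwoArmProb_of_tendstoLaw`) and the continuum crossing probabilities
`(ν (Dn n)) Cross(1, n)` have exponent `-1/4` along the integers (Smirnov–Werner 2001, §4 (9) with
(12), (13), (15), `j = 2`: the radial `SLE₆` computation `b'_2(λ) = λ^{-1/4+o(1)}`), then the named
fact holds (`SmirnovWerner2001_twoArm_scalingLimit_of_limits_nat` with
`L(r, R) := (ν (Dn R)) Cross(r, R)`). [cite: SmirnovWernerMRL2001, §4 (9), (16)] -/
theorem SmirnovWerner2001_twoArm_scalingLimit_of_loopLimit
    (ν : JordanDomain → Measure (LoopSpace ℂ)) (hν : ∀ D, IsProbabilityMeasure (ν D))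
    (hconv : ∀ D : JordanDomain, TendstoLaw (Ωδ := fun _ ↦ SiteConfig (Site 2))
      (fun δ ↦ triLoopCollection D δ) (fun _ ↦ triSitePercolation half) id (ν D))
    (Dn : ℕ → JordanDomain) (hDn : ∀ n : ℕ, closedBall (0 : ℂ) (n + 2) ⊆ (Dn n).carrier)
    (hnull : ∀ r R : ℕ, 1 ≤ r → r < R →
      ν (Dn R) {L : LoopSpace ℂ | (∀ ε > 0, ∃ c ∈ L, (∃ z ∈ CurveClass.range c, hexGauge z ≤ r + ε) ∧
          ∃ z ∈ CurveClass.range c, R - ε ≤ hexGauge z) ∧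
        ¬ ∃ c ∈ L, (∃ z ∈ CurveClass.range c, hexGauge z < r) ∧ ∃ z ∈ CurveClass.range c, (R : ℝ) < hexGauge z} = 0)
    (hexp : Tendsto (fun n : ℕ ↦ Real.log ((ν (Dn n)).real (loopHexCrossing (1 : ℝ) (n : ℝ))) / Real.log n)
      atTop (𝓝 (-(1 / 4)))) :
    SmirnovWerner2001_twoArm_scalingLimit := by
  refine SmirnovWerner2001_twoArm_scalingLimit_of_limits_nat (fun r R ↦ (ν (Dn R)).real (loopHexCrossing (r : ℝ) (R : ℝ)))
    (fun r R hr hrR ↦ ?_) (by simpa only [Nat.cast_one] using hexp)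
  haveI := hν (Dn R)
  exact tendsto_critTwoArmProb_of_tendstoLaw hr hrR.le (Dn R) (hDn R) (hconv (Dn R))
    (measure_iInter_closure_diff_iUnion_interior_eq_zero (hnull r R hr hrR))

/-- **The named fact from `exists_isCNLFamily_tendsto` and two properties of the Camia–Newman
limit**, the properties being required of every CNL family that is the scaling limit (there is at
most one, `cnlFamily_unique`): no near misses at the integer hexagonal annuli, and the exponent
`-1/4` of the continuum annulus-crossing probability (Smirnov–Werner 2001, §4 (9), (16)).
[cite: SmirnovWernerMRL2001, §4 (9), (16)] -/
theorem SmirnovWerner2001_twoArm_scalingLimit_of_cnl (h : exists_isCNLFamily_tendsto)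
    (Dn : ℕ → JordanDomain) (hDn : ∀ n : ℕ, closedBall (0 : ℂ) (n + 2) ⊆ (Dn n).carrier)
    (hnull : ∀ ν : JordanDomain → Measure (LoopSpace ℂ), IsCNLFamily ν →
      (∀ D : JordanDomain, TendstoLaw (Ωδ := fun _ ↦ SiteConfig (Site 2))
        (fun δ ↦ triLoopCollection D δ) (fun _ ↦ triSitePercolation half) id (ν D)) →
      ∀ r R : ℕ, 1 ≤ r → r < R →
        ν (Dn R) {L : LoopSpace ℂ | (∀ ε > 0, ∃ c ∈ L, (∃ z ∈ CurveClass.range c, hexGauge z ≤ r + ε) ∧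
            ∃ z ∈ CurveClass.range c, R - ε ≤ hexGauge z) ∧
          ¬ ∃ c ∈ L, (∃ z ∈ CurveClass.range c, hexGauge z < r) ∧ ∃ z ∈ CurveClass.range c, (R : ℝ) < hexGauge z} = 0)
    (hexp : ∀ ν : JordanDomain → Measure (LoopSpace ℂ), IsCNLFamily ν →
      (∀ D : JordanDomain, TendstoLaw (Ωδ := fun _ ↦ SiteConfig (Site 2))
        (fun δ ↦ triLoopCollection D δ) (fun _ ↦ triSitePercolation half) id (ν D)) →
      Tendsto (fun n : ℕ ↦ Real.log ((ν (Dn n)).real (loopHexCrossing (1 : ℝ) (n : ℝ))) / Real.log n)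
        atTop (𝓝 (-(1 / 4)))) :
    SmirnovWerner2001_twoArm_scalingLimit := by
  obtain ⟨ν, hν, hconv⟩ := h
  exact SmirnovWerner2001_twoArm_scalingLimit_of_loopLimit ν hν.isProbabilityMeasure hconv Dn hDn
    (hnull ν hν hconv) (hexp ν hν hconv)

end Literature.Probability.Percolation
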